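import Summits.CriticalPhenomena.SAWScalingLimit.Theorems.SAWTotalPositivityCriticalBubbleBoundJoinUnfoldPrep

/-!
# Hammond's unfolding of polygons with many global join plaquettes, II: the detoured tail
(line `docking-census-joining`, stub `gjoins_dtail`, infrastructure for stub `gjoins_unfold`)

Crux `stmt-CriticalPhenomena-7117`
(`Summit.CriticalPhenomena.SAWScalingLimit.Theses.SAWTotalPositivity.CriticalBubbleBound`), line
`docking-census-joining`, JOIN-MASS programme (lead c6); second of three files on the multi-valued
map of Hammond's Proposition 4.5 (`…JoinUnfoldPrep`, this file, `…JoinUnfold`).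

For a lex-rooted polygon `χ ∈ lexRooted N` and a set `κ` of pairwise non-touching global join
plaquettes, the DETOURED TAIL (`Unfold.dtail`, Hammond's `φ^{2,κ}`) is the tail arc
`χ (esIdx), …, χ N` (from `ES` to `e₀`) in which the step across the side of each plaquette of `κ` is
replaced by the three-step detour around the plaquette (`Unfold.det`). Registered stub `gjoins_dtail`:
it is a self-avoiding lattice path with `N - esIdx + 1 + 2|κ|` vertices inside `{x ≤ xmax, y ≥ 0}`
(detour vertices are head vertices by Lemma 4.7 and `gjoins_esStep_ne_side`, hence not tail vertices;
detours at different steps are corners of different, non-touching plaquettes; the marked steps are in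
bijection with `κ`). PARSING (`Unfold.dtail_parse`): two polygons with the same head and the same
detoured tail have the same tail and the same detours (the next tail vertex is the first non-head
vertex after a detour).

Sources: A. Hammond, Ann. Probab. 46 (2018) = arXiv:1808.09032, proof of Proposition 4.5;
N. Madras, G. Slade, *The Self-Avoiding Walk* (1993), §3.1. Elementary combinatorics ([folklore]).
-/

noncomputable section

open Literature.Probability.LatticeModels
open Literature.Probability.RandomPlanarGeometry Literature.Probability.RandomPlanarGeometry.SAW
open scoped BigOperators
open Summit.CriticalPhenomena.SAWScalingLimit.Theorems.CriticalBubbleBound.Negative (e₀)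
open Summit.CriticalPhenomena.SAWScalingLimit.Theorems.CriticalBubbleBound.Docking

namespace Summit.CriticalPhenomena.SAWScalingLimit.Theorems.CriticalBubbleBound.Join

variable {N : ℕ} {χ : ℕ → Site 2} {κ : Finset (Site 2)}

namespace Unfold

/-! ## The detoured tail -/

open Classical in
/-- The DETOUR inserted after the tail vertex `χ i`: if the tail step `{χ i, χ (i+1)}` is the lower
side of a plaquette of `κ`, the two upper corners (in the direction of travel); if it is the upper
side, the two lower corners; otherwise nothing. [cite: Hammond2015SAPJoining, Proposition 4.5] -/
def det (χ : ℕ → Site 2) (κ : Finset (Site 2)) (i : ℕ) : List (Site 2) :=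
  if ∃ q ∈ κ, s(χ i, χ (i + 1)) = s(q, q + e₀) then [χ i + e₁, χ (i + 1) + e₁]
  else if ∃ q ∈ κ, s(χ i, χ (i + 1)) = s(q + e₁, q + e₀ + e₁) then [χ i - e₁, χ (i + 1) - e₁]
  else []

/-- The DETOURED TAIL `χ(N-k), …, χ N` with the detours inserted (Hammond's `φ^{2,κ}`), as a
vertex list. [cite: Hammond2015SAPJoining, Proposition 4.5] -/
def dtail (N : ℕ) (χ : ℕ → Site 2) (κ : Finset (Site 2)) : ℕ → List (Site 2)
  | 0 => [χ N]
  | k + 1 => (χ (N - (k + 1)) :: det χ κ (N - (k + 1))) ++ dtail N χ κ k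

/-- There is a (two-vertex) detour exactly at the tail steps across a side of a plaquette of
`κ`. [folklore] -/
theorem det_ne_nil_iff (χ : ℕ → Site 2) (κ : Finset (Site 2)) (i : ℕ) :
    det χ κ i ≠ [] ↔ ∃ q ∈ κ, s(χ i, χ (i + 1)) = s(q, q + e₀) ∨
      s(χ i, χ (i + 1)) = s(q + e₁, q + e₀ + e₁) := by
  unfold det
  split_ifs with h₁ h₂
  · obtain ⟨q, hq, h⟩ := h₁
    exact ⟨fun _ => ⟨q, hq, Or.inl h⟩, fun _ => List.cons_ne_nil _ _⟩
  · obtain ⟨q, hq, h⟩ := h₂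
    exact ⟨fun _ => ⟨q, hq, Or.inr h⟩, fun _ => List.cons_ne_nil _ _⟩
  · simp only [ne_eq, not_true_eq_false, false_iff, not_exists, not_and, not_or]
    exact fun q hq => ⟨fun h => h₁ ⟨q, hq, h⟩, fun h => h₂ ⟨q, hq, h⟩⟩

/-- A detour has two vertices. [folklore] -/
theorem length_det (χ : ℕ → Site 2) (κ : Finset (Site 2)) (i : ℕ) :
    (det χ κ i).length = 2 * if det χ κ i ≠ [] then 1 else 0 := by
  unfold det
  split_ifs <;> simp_all

/-- What a detour vertex is: a corner of a plaquette `q ∈ κ` whose side the tail step crosses,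
and a HEAD vertex `χ l`, `l < esIdx`. [cite: Hammond2015SAPJoining, Proposition 4.5] -/
theorem det_spec (hχ : χ ∈ lexRooted N) (hN : 3 ≤ N) (hκ : κ ⊆ gjoins N χ) {i : ℕ}
    (hji : esIdx N χ ≤ i) (hiN : i < N) {d : Site 2} (hd : d ∈ det χ κ i) :
    ∃ q ∈ κ, (s(χ i, χ (i + 1)) = s(q, q + e₀) ∨ s(χ i, χ (i + 1)) = s(q + e₁, q + e₀ + e₁)) ∧
      ((d 0 = q 0 ∨ d 0 = q 0 + 1) ∧ (d 1 = q 1 ∨ d 1 = q 1 + 1)) ∧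
      ∃ l, l < esIdx N χ ∧ χ l = d := by
  unfold det at hd
  split_ifs at hd with h₁ h₂
  · obtain ⟨q, hq, hlo⟩ := h₁
    obtain ⟨i', hi', hhi⟩ := (head_cross hχ hN (hκ hq) hji hiN).1 hlo
    simp only [List.mem_cons, List.not_mem_nil, or_false] at hd
    have hd' : d = q + e₁ ∨ d = q + e₀ + e₁ := by
      rcases Sym2.eq_iff.1 hlo with ⟨ha, hb⟩ | ⟨ha, hb⟩ <;> rcases hd with rfl | rfl
      · exact Or.inl (by rw [ha])
      · exact Or.inr (by rw [hb])
      · exact Or.inr (by rw [ha])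
      · exact Or.inl (by rw [hb])
    refine ⟨q, hq, Or.inl hlo, corner_of_mem (Or.inr (Or.inr hd')), ?_⟩
    rcases Sym2.eq_iff.1 hhi with ⟨ha, hb⟩ | ⟨ha, hb⟩ <;> rcases hd' with rfl | rfl
    · exact ⟨i', by omega, ha⟩
    · exact ⟨i' + 1, hi', hb⟩
    · exact ⟨i' + 1, hi', hb⟩
    · exact ⟨i', by omega, ha⟩
  · obtain ⟨q, hq, hhi⟩ := h₂
    obtain ⟨i', hi', hlo⟩ := (head_cross hχ hN (hκ hq) hji hiN).2 hhi
    simp only [List.mem_cons, List.not_mem_nil, or_false] at hd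
    have hd' : d = q ∨ d = q + e₀ := by
      rcases Sym2.eq_iff.1 hhi with ⟨ha, hb⟩ | ⟨ha, hb⟩ <;> rcases hd with rfl | rfl
      · exact Or.inl (by rw [ha, add_sub_cancel_right])
      · exact Or.inr (by rw [hb, add_sub_cancel_right])
      · exact Or.inr (by rw [ha, add_sub_cancel_right])
      · exact Or.inl (by rw [hb, add_sub_cancel_right])
    refine ⟨q, hq, Or.inr hhi, corner_of_mem (hd'.imp id Or.inl), ?_⟩
    rcases Sym2.eq_iff.1 hlo with ⟨ha, hb⟩ | ⟨ha, hb⟩ <;> rcases hd' with rfl | rfl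
    · exact ⟨i', by omega, ha⟩
    · exact ⟨i' + 1, hi', hb⟩
    · exact ⟨i' + 1, hi', hb⟩
    · exact ⟨i', by omega, ha⟩
  · exact absurd hd List.not_mem_nil

/-- `dtail k` starts at `χ (N - k)`. [folklore] -/
theorem head?_dtail (N : ℕ) (χ : ℕ → Site 2) (κ : Finset (Site 2)) :
    ∀ k, (dtail N χ κ k).head? = some (χ (N - k))
  | 0 => rfl
  | _ + 1 => rfl

/-- `dtail k` ends at `χ N`. [folklore] -/
theorem getLast?_dtail (N : ℕ) (χ : ℕ → Site 2) (κ : Finset (Site 2)) :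
    ∀ k, (dtail N χ κ k).getLast? = some (χ N)
  | 0 => rfl
  | k + 1 => by
    rw [dtail, List.getLast?_append, getLast?_dtail N χ κ k]
    rfl

/-- Length of the detoured tail: one vertex per tail vertex plus the detours. [folklore] -/
theorem length_dtail (N : ℕ) (χ : ℕ → Site 2) (κ : Finset (Site 2)) :
    ∀ k, k ≤ N → (dtail N χ κ k).length = k + 1 + ∑ i ∈ Finset.Ico (N - k) N, (det χ κ i).length
  | 0, _ => by simp [dtail]
  | k + 1, hk => by
    rw [dtail, List.length_append, List.length_cons, length_dtail N χ κ k (by omega),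
      Finset.sum_eq_sum_Ico_succ_bot (by omega : N - (k + 1) < N),
      show N - (k + 1) + 1 = N - k by omega]
    ring

/-- The vertices of the detoured tail: tail vertices `χ k'`, `N - k ≤ k' ≤ N`, and detour
vertices. [folklore] -/
theorem mem_dtail (N : ℕ) (χ : ℕ → Site 2) (κ : Finset (Site 2)) :
    ∀ k, k ≤ N → ∀ x ∈ dtail N χ κ k, (∃ k', N - k ≤ k' ∧ k' ≤ N ∧ χ k' = x) ∨
      ∃ i, N - k ≤ i ∧ i < N ∧ x ∈ det χ κ i
  | 0, _, x, hx => by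
    rw [dtail, List.mem_singleton] at hx
    exact Or.inl ⟨N, by omega, le_rfl, hx.symm⟩
  | k + 1, hk, x, hx => by
    rw [dtail, List.mem_append, List.mem_cons] at hx
    rcases hx with (rfl | hx) | hx
    · exact Or.inl ⟨_, le_rfl, by omega, rfl⟩
    · exact Or.inr ⟨_, le_rfl, by omega, hx⟩
    · rcases mem_dtail N χ κ k (by omega) x hx with ⟨k', h1, h2, h3⟩ | ⟨i, h1, h2, h3⟩
      · exact Or.inl ⟨k', by omega, h2, h3⟩
      · exact Or.inr ⟨i, by omega, h2, h3⟩

/-- Adjacency inside a piece `χ i :: det i`, and from its last vertex to `χ (i+1)`. [folklore] -/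
theorem isChain_piece (hχ : χ ∈ Zd.sawFun 2 N e₀) (κ : Finset (Site 2)) {i : ℕ} (hiN : i < N) :
    List.IsChain (fun a b => (zdGraph 2).Adj a b) (χ i :: det χ κ i) ∧
      ∀ x ∈ (χ i :: det χ κ i).getLast?, (zdGraph 2).Adj x (χ (i + 1)) := by
  have hadj := (Zd.mem_sawFun.1 hχ).2.2.1 i hiN
  have hsub : ∀ a : Site 2, (zdGraph 2).Adj a (a - e₁) := fun a => by
    have := adj_add_e₁ (a - e₁)
    rw [sub_add_cancel] at this
    exact this.symm
  unfold det
  split_ifs with h₁ h₂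
  · refine ⟨?_, fun x hx => ?_⟩
    · simp only [List.isChain_cons_cons, List.isChain_singleton, and_true]
      exact ⟨adj_add_e₁ _, (Zd.zdGraph_adj_add_right _ _ _).2 hadj⟩
    · simp only [List.getLast?_cons_cons, List.getLast?_singleton, Option.mem_def,
        Option.some.injEq] at hx
      rw [← hx]
      exact (adj_add_e₁ _).symm
  · refine ⟨?_, fun x hx => ?_⟩
    · simp only [List.isChain_cons_cons, List.isChain_singleton, and_true]
      exact ⟨hsub _, (Zd.zdGraph_adj_sub_right _ _ _).2 hadj⟩
    · simp only [List.getLast?_cons_cons, List.getLast?_singleton, Option.mem_def,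
        Option.some.injEq] at hx
      rw [← hx]
      exact (hsub _).symm
  · refine ⟨List.isChain_singleton _, fun x hx => ?_⟩
    simp only [List.getLast?_singleton, Option.mem_def, Option.some.injEq] at hx
    rw [← hx]
    exact hadj

/-- The detoured tail is a lattice path. [folklore] -/
theorem isChain_dtail (hχ : χ ∈ Zd.sawFun 2 N e₀) (κ : Finset (Site 2)) :
    ∀ k, k ≤ N → List.IsChain (fun a b => (zdGraph 2).Adj a b) (dtail N χ κ k)
  | 0, _ => List.isChain_singleton _
  | k + 1, hk => by
    rw [dtail]
    obtain ⟨h1, h2⟩ := isChain_piece hχ κ (show N - (k + 1) < N by omega)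
    refine List.IsChain.append h1 (isChain_dtail hχ κ k (by omega)) fun x hx y hy => ?_
    rw [head?_dtail, Option.mem_def, Option.some.injEq] at hy
    rw [← hy, show N - k = N - (k + 1) + 1 by omega]
    exact h2 x hx

/-- A detour visits two distinct vertices. [folklore] -/
theorem nodup_det (hχ : χ ∈ Zd.sawFun 2 N e₀) (κ : Finset (Site 2)) {i : ℕ} (hiN : i < N) :
    (det χ κ i).Nodup := by
  have hne : χ i ≠ χ (i + 1) := fun h => by
    have := (Zd.mem_sawFun.1 hχ).2.2.2 (show i ≤ N by omega) (show i + 1 ≤ N by omega) h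
    omega
  unfold det
  split_ifs <;> simp [hne]

/-- The detoured tail is self-avoiding: tail vertices are distinct (self-avoidance of `χ`),
detour vertices are head vertices (hence not tail vertices), and detours at different steps are
corners of different, non-touching plaquettes. [cite: Hammond2015SAPJoining, Proposition 4.5] -/
theorem nodup_dtail (hχ : χ ∈ lexRooted N) (hN : 3 ≤ N) (hκ : κ ⊆ gjoins N χ)
    (hnt : ∀ q ∈ κ, ∀ q' ∈ κ, q ≠ q' → 2 ≤ |q 0 - q' 0| ∨ 2 ≤ |q 1 - q' 1|) :
    ∀ k, k ≤ N - esIdx N χ → (dtail N χ κ k).Nodup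
  | 0, _ => List.nodup_singleton _
  | k + 1, hk => by
    have hsaw := lexRooted_subset N hχ
    have hinj := (Zd.mem_sawFun.1 hsaw).2.2.2
    have hjN := (esIdx_spec N χ).1
    have hji : esIdx N χ ≤ N - (k + 1) := by omega
    have hiN : N - (k + 1) < N := by omega
    have hHT : ∀ {l k' : ℕ}, l < esIdx N χ → esIdx N χ ≤ k' → k' ≤ N → χ l ≠ χ k' :=
      fun hl hk1 hk2 h => by
        have := hinj (show _ ≤ N by omega) (show _ ≤ N by omega) h
        omega
    rw [dtail, List.nodup_append]
    refine ⟨List.nodup_cons.2 ⟨fun hmem => ?_, nodup_det hsaw κ hiN⟩,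
      nodup_dtail hχ hN hκ hnt k (by omega), fun a ha b hb hab => ?_⟩
    · obtain ⟨-, -, -, -, l, hl, hlx⟩ := det_spec hχ hN hκ hji hiN hmem
      exact hHT hl hji (by omega) hlx
    · subst hab
      rw [List.mem_cons] at ha
      rcases mem_dtail N χ κ k (by omega) a hb with ⟨k', hk', hk'N, rfl⟩ | ⟨i, hi, hi', hmem⟩
      · rcases ha with ha | ha
        · have := hinj (show k' ≤ N from hk'N) (show N - (k + 1) ≤ N by omega) ha
          omega
        · obtain ⟨-, -, -, -, l, hl, hlx⟩ := det_spec hχ hN hκ hji hiN ha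
          exact hHT hl (by omega) hk'N hlx
      · obtain ⟨q, hq, hs, hc, l, hl, hlx⟩ := det_spec hχ hN hκ (by omega) hi' hmem
        rcases ha with ha | ha
        · exact hHT hl hji (by omega) (hlx.trans ha)
        · obtain ⟨q₀, hq₀, hs₀, hc₀, -⟩ := det_spec hχ hN hκ hji hiN ha
          rcases eq_or_ne q₀ q with rfl | hqq
          · have := tail_unique hχ hN (hκ hq) hji hiN (by omega) hi' hs₀ hs
            omega
          · exact corner_ne (hnt q₀ hq₀ q hq hqq) hc₀ hc rfl

open Classical in
/-- The marked tail steps are in bijection with `κ`. [cite: Hammond2015SAPJoining, Lemma 4.7] -/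
theorem card_marked (hχ : χ ∈ lexRooted N) (hN : 3 ≤ N) (hκ : κ ⊆ gjoins N χ)
    (hnt : ∀ q ∈ κ, ∀ q' ∈ κ, q ≠ q' → 2 ≤ |q 0 - q' 0| ∨ 2 ≤ |q 1 - q' 1|) :
    ((Finset.Ico (esIdx N χ) N).filter fun i => det χ κ i ≠ []).card = κ.card := by
  symm
  refine Finset.card_bij (fun q hq => Classical.choose (gjoins_arcs N χ hχ hN q (hκ hq)).2)
    (fun q hq => ?_) (fun q₁ h₁ q₂ h₂ h => ?_) (fun i hi => ?_)
  · obtain ⟨h1, h2, h3⟩ := Classical.choose_spec (gjoins_arcs N χ hχ hN q (hκ hq)).2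
    exact Finset.mem_filter.2 ⟨Finset.mem_Ico.2 ⟨h1, h2⟩, (det_ne_nil_iff χ κ _).2 ⟨q, hq, h3⟩⟩
  · obtain ⟨-, -, h3⟩ := Classical.choose_spec (gjoins_arcs N χ hχ hN q₁ (hκ h₁)).2
    obtain ⟨-, -, h4⟩ := Classical.choose_spec (gjoins_arcs N χ hχ hN q₂ (hκ h₂)).2
    rw [h] at h3
    exact sides_unique hnt h₁ h₂ h3 h4
  · obtain ⟨hi, hi'⟩ := Finset.mem_filter.1 hi
    obtain ⟨q, hq, hs⟩ := (det_ne_nil_iff χ κ i).1 hi'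
    obtain ⟨h1, h2, h3⟩ := Classical.choose_spec (gjoins_arcs N χ hχ hN q (hκ hq)).2
    exact ⟨q, hq, tail_unique hχ hN (hκ hq) h1 h2 (Finset.mem_Ico.1 hi).1 (Finset.mem_Ico.1 hi).2
      h3 hs⟩

open Classical in
/-- The detours add `2 |κ|` vertices. [folklore] -/
theorem sum_length_det (hχ : χ ∈ lexRooted N) (hN : 3 ≤ N) (hκ : κ ⊆ gjoins N χ)
    (hnt : ∀ q ∈ κ, ∀ q' ∈ κ, q ≠ q' → 2 ≤ |q 0 - q' 0| ∨ 2 ≤ |q 1 - q' 1|) :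
    ∑ i ∈ Finset.Ico (esIdx N χ) N, (det χ κ i).length = 2 * κ.card := by
  rw [Finset.sum_congr rfl fun i _ => length_det χ κ i, ← Finset.mul_sum, ← Finset.card_filter,
    card_marked hχ hN hκ hnt]

/-- The detoured tail lies in the half-plane `{x ≤ xmax}` and above row `0`: its vertices are
vertices of `χ`. [folklore] -/
theorem coord_dtail (hχ : χ ∈ lexRooted N) (hN : 3 ≤ N) (hκ : κ ⊆ gjoins N χ) {k : ℕ} (hk : k ≤ N)
    {x : Site 2} (hx : x ∈ dtail N χ κ k) (hk' : esIdx N χ ≤ N - k) :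
    x 0 ≤ xmax N χ ∧ 0 ≤ x 1 := by
  rcases mem_dtail N χ κ k hk x hx with ⟨k', -, hk'N, rfl⟩ | ⟨i, hi, hiN, hmem⟩
  · exact ⟨apply_le_xmax χ hk'N, apply_one_nonneg_of_mem_lexRooted hχ hk'N⟩
  · obtain ⟨-, -, -, -, l, hl, rfl⟩ := det_spec hχ hN hκ (by omega) hiN hmem
    have hlN : l ≤ N := by have := (esIdx_spec N χ).1; omega
    exact ⟨apply_le_xmax χ hlN, apply_one_nonneg_of_mem_lexRooted hχ hlN⟩

/-! ## Parsing the detoured tail -/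

/-- If two detoured tails agree from a tail step on and one has no detour at that step, neither
has: otherwise the other's first detour vertex, a head vertex, would be the next tail vertex.
[folklore] -/
theorem parse_aux {χ' : ℕ → Site 2} {κ' : Finset (Site 2)} (hχ : χ ∈ lexRooted N)
    (hχ' : χ' ∈ lexRooted N) (hN : 3 ≤ N) (hκ' : κ' ⊆ gjoins N χ') (hj : esIdx N χ = esIdx N χ')
    (hhead : ∀ l ≤ esIdx N χ, χ l = χ' l) {k : ℕ} (hk : k + 1 ≤ N - esIdx N χ)
    (hnil : det χ κ (N - (k + 1)) = [])
    (h : det χ κ (N - (k + 1)) ++ dtail N χ κ k = det χ' κ' (N - (k + 1)) ++ dtail N χ' κ' k) :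
    det χ' κ' (N - (k + 1)) = [] := by
  by_contra hne
  obtain ⟨a, ha⟩ : ∃ a, (det χ' κ' (N - (k + 1))).head? = some a :=
    Option.ne_none_iff_exists'.1 (by simpa using hne)
  have h1 : (dtail N χ κ k).head? = some a := by
    rw [hnil, List.nil_append] at h
    rw [h, List.head?_append, ha, Option.some_or]
  rw [head?_dtail, Option.some.injEq] at h1
  have hjN := (esIdx_spec N χ).1
  obtain ⟨-, -, -, -, l, hl, hla⟩ :=
    det_spec hχ' hN hκ' (by omega) (by omega) (List.mem_of_mem_head? ha)
  have hinj := (Zd.mem_sawFun.1 (lexRooted_subset N hχ)).2.2.2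
  have := hinj (show l ≤ N by omega) (show N - k ≤ N by omega)
    (by rw [hhead l (by omega), hla, ← h1])
  omega

/-- PARSING: two lex-rooted polygons with the same head whose detoured tails coincide have the
same tail and the same detours (induction along the tail: the next tail vertex is the first
non-head vertex). [cite: Hammond2015SAPJoining, Proposition 4.5] -/
theorem dtail_parse {χ' : ℕ → Site 2} {κ' : Finset (Site 2)} (hχ : χ ∈ lexRooted N)
    (hχ' : χ' ∈ lexRooted N) (hN : 3 ≤ N) (hκ : κ ⊆ gjoins N χ) (hκ' : κ' ⊆ gjoins N χ')
    (hj : esIdx N χ = esIdx N χ') (hhead : ∀ l ≤ esIdx N χ, χ l = χ' l) :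
    ∀ k, k ≤ N - esIdx N χ → dtail N χ κ k = dtail N χ' κ' k →
      (∀ i, N - k ≤ i → i ≤ N → χ i = χ' i) ∧ ∀ i, N - k ≤ i → i < N → det χ κ i = det χ' κ' i
  | 0, _, h => by
    have h' : χ N = χ' N := by simpa [dtail] using h
    refine ⟨fun i h1 h2 => ?_, fun i h1 h2 => by omega⟩
    obtain rfl : i = N := by omega
    exact h'
  | k + 1, hk, h => by
    rw [dtail, dtail, List.cons_append, List.cons_append, List.cons.injEq] at h
    obtain ⟨h0, h⟩ := h
    have key : det χ κ (N - (k + 1)) = det χ' κ' (N - (k + 1)) ∧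
        dtail N χ κ k = dtail N χ' κ' k := by
      refine List.append_inj h ?_
      rw [length_det, length_det]
      by_cases h₁ : det χ κ (N - (k + 1)) = []
      · have h₂ := parse_aux hχ hχ' hN hκ' hj hhead hk h₁ h
        rw [h₁, h₂]
      · by_cases h₂ : det χ' κ' (N - (k + 1)) = []
        · have hhead' : ∀ l ≤ esIdx N χ', χ' l = χ l := fun l hl => (hhead l (by omega)).symm
          exact absurd (parse_aux hχ' hχ hN hκ hj.symm hhead' (by omega) h₂ h.symm) h₁
        · rw [if_pos h₁, if_pos h₂]
    obtain ⟨ht, hd⟩ := dtail_parse hχ hχ' hN hκ hκ' hj hhead k (by omega) key.2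
    refine ⟨fun i h1 h2 => ?_, fun i h1 h2 => ?_⟩
    · rcases Nat.lt_or_ge i (N - k) with hi | hi
      · obtain rfl : i = N - (k + 1) := by omega
        exact h0
      · exact ht i hi h2
    · rcases Nat.lt_or_ge i (N - k) with hi | hi
      · obtain rfl : i = N - (k + 1) := by omega
        exact key.1
      · exact hd i hi h2

end Unfold

/-- **Stub `gjoins_dtail`.** The detoured tail of a lex-rooted polygon around `κ` (pairwise
non-touching global join plaquettes) is a self-avoiding lattice path with `N - esIdx + 1 + 2|κ|`
vertices in the region `{x ≤ xmax, y ≥ 0}`. [cite: Hammond2015SAPJoining, Proposition 4.5] -/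
theorem gjoins_dtail : ∀ (N : ℕ) (χ : ℕ → Site 2) (κ : Finset (Site 2)), χ ∈ lexRooted N → 3 ≤ N → κ ⊆ gjoins N χ → (∀ q ∈ κ, ∀ q' ∈ κ, q ≠ q' → 2 ≤ |q 0 - q' 0| ∨ 2 ≤ |q 1 - q' 1|) → (Unfold.dtail N χ κ (N - esIdx N χ)).length = N - esIdx N χ + 1 + 2 * κ.card ∧ (Unfold.dtail N χ κ (N - esIdx N χ)).Nodup ∧ List.IsChain (fun a b => (zdGraph 2).Adj a b) (Unfold.dtail N χ κ (N - esIdx N χ)) ∧ ∀ x ∈ Unfold.dtail N χ κ (N - esIdx N χ), x 0 ≤ xmax N χ ∧ 0 ≤ x 1 := by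
  intro N χ κ hχ hN hκ hnt
  have hjN := (esIdx_spec N χ).1
  refine ⟨?_, Unfold.nodup_dtail hχ hN hκ hnt _ le_rfl,
    Unfold.isChain_dtail (lexRooted_subset N hχ) κ _ (by omega), fun x hx =>
    Unfold.coord_dtail hχ hN hκ (by omega) hx (by omega)⟩
  rw [Unfold.length_dtail N χ κ _ (by omega), show N - (N - esIdx N χ) = esIdx N χ by omega,
    Unfold.sum_length_det hχ hN hκ hnt]

end Summit.CriticalPhenomena.SAWScalingLimit.Theorems.CriticalBubbleBound.Join

end
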